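import Mathlib
import Literature.NumberTheory.Transcendental.ZagierDilogarithmConjecture
import Literature.NumberTheory.Transcendental.PreBlochGroup
import Literature.NumberTheory.Transcendental.PreBlochPlaces
import Summits.KontsevichZagierPeriods.KontsevichZagierPeriods.Theorems.HyperbolicBlochZagierDilogarithmConjectureStubTwoSaturation
import Summits.KontsevichZagierPeriods.KontsevichZagierPeriods.Theorems.HyperbolicBlochZagierDilogarithmConjectureStubDistributionSlice
import HarnessLib

/-!
# `ZagierDilogarithmConjecture` (stmt-KontsevichZagierPeriods-10550) — line `kummer-clausen-linearisation`
# (c5 cycle 4, "Gaussian exceptional-unit sector"): the anharmonic relators in `ℤ[ℂ]`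

For an algebraic `x ∉ {0, 1}` the six anharmonic images `x, x⁻¹, 1 − x, (1 − x)⁻¹, 1 − x⁻¹, x/(x − 1)` have classes
`[g x] ≡ ±[x]` modulo `⟨dilogRelators⟩ ⊆ ℤ[ℂ]`: the identities `⟦x⁻¹⟧ = −⟦x⟧`, `⟦1 − x⟧ = −⟦x⟧`, `⟦(1−x)⁻¹⟧ = ⟦x⟧`,
`⟦1 − x⁻¹⟧ = ⟦x⟧`, `⟦x/(x−1)⟧ = −⟦x⟧` of the extended symbol in the pre-Bloch group of `ℚ̄` (`PreBlochPlaces`), pushed to `ℤ[ℂ]`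
by the symbol lift (`distrib_exists_symLift`) and `closure_fiveTerm_le_comap`. Stated with the image `y` as a separate variable
and the defining identity in multiplicative form (`x * y = 1`, …), so that instances at numerical literals are discharged by
`norm_num`. Also: Gaussian rationals are algebraic. Registered stub `stub_anharmonicRelators` (conjunction). Lead c5 cycle 4.
Sorry-free; axioms ⊆ {propext, Classical.choice, Quot.sound}.
-/

noncomputable section

open scoped BigOperators ComplexConjugate
open Literature.NumberTheory.Transcendental

namespace Summit.KontsevichZagierPeriods.HyperbolicBloch.ZagierDilogarithmCertificate

/-- A complex number with rational real and imaginary parts is algebraic over `ℚ`. [folklore] -/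
theorem gaussRat_isAlgebraic' (z : ℂ) (a b : ℚ) (h : z = a + b * Complex.I) : IsAlgebraic ℚ z := by
  subst h
  have hI : IsAlgebraic ℚ Complex.I := by
    refine ⟨Polynomial.X ^ 2 + 1, ?_, ?_⟩
    · intro h0
      have h1 := congrArg (Polynomial.eval 0) h0
      simp at h1
    · simp
  exact (isAlgebraic_algebraMap a).add ((isAlgebraic_algebraMap b).mul hI)

/-- **Transport of a two-term symbol identity.** If `x, y` are algebraic, `∉ {0,1}`, and in the pre-Bloch group of `ℚ̄` the
extended symbols satisfy `⟦x⟧ + ε⟦y⟧ = 0` (`ε = ±1`), then `[x] + ε[y] ∈ ⟨dilogRelators⟩` in `ℤ[ℂ]`. [cite: Neumann1998, §2 eq. (2.3)] -/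
theorem of_add_zsmul_of_mem_of_sym (x y : ℂ) (ε : ℤ) (hx : IsAlgebraic ℚ x) (hy : IsAlgebraic ℚ y)
    (H : ∀ (Q : IntermediateField ℚ ℂ) [IsAlgClosed Q] (X Y : Q), (X : ℂ) = x → (Y : ℂ) = y →
      PreBloch.sym X + ε • PreBloch.sym Y = 0) :
    FreeAbelianGroup.of x + ε • FreeAbelianGroup.of y ∈ AddSubgroup.closure dilogRelators := by
  classical
  set Q : IntermediateField ℚ ℂ := algebraicClosure ℚ ℂ with hQdef
  haveI : IsAlgClosure ℚ Q := algebraicClosure.isAlgClosure ℚ ℂ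
  haveI : IsAlgClosed Q := IsAlgClosure.isAlgClosed ℚ
  have hQ : ∀ z, z ∈ Q ↔ IsAlgebraic ℚ z := fun _ => mem_algebraicClosure_iff
  let X : Q := ⟨x, (hQ _).2 hx⟩
  let Y : Q := ⟨y, (hQ _).2 hy⟩
  have ID := H Q X Y rfl rfl
  obtain ⟨s, hs1, hs2⟩ :=
    Summit.KontsevichZagierPeriods.HyperbolicBloch.ZagierDilogarithmGaloisDescent.distrib_exists_symLift (Q := Q)
  let ι : FreeAbelianGroup (PreBloch.Gen Q) →+ FreeAbelianGroup ℂ :=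
    FreeAbelianGroup.lift fun g => FreeAbelianGroup.of (g.val : ℂ)
  have hι : ∀ g, ι (FreeAbelianGroup.of g) = FreeAbelianGroup.of (g.val : ℂ) := fun g =>
    FreeAbelianGroup.lift_apply_of _ _
  have hE : PreBloch.proj (s X + ε • s Y) = 0 := by
    simp only [map_add, map_zsmul,
      Summit.KontsevichZagierPeriods.HyperbolicBloch.ZagierDilogarithmGaloisDescent.distrib_proj_symLift hs1 hs2]
    exact ID
  have hιE : ι (s X + ε • s Y) ∈ AddSubgroup.closure dilogRelators :=
    Summit.KontsevichZagierPeriods.HyperbolicBloch.ZagierDilogarithm.closure_fiveTerm_le_comap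
      (fun z hz => (hQ z).1 hz) ι hι ((PreBloch.proj_eq_zero_iff _).1 hE)
  have h1 := Summit.KontsevichZagierPeriods.HyperbolicBloch.ZagierDilogarithmGaloisDescent.distrib_iota_symLift_sub_mem
    hs1 hs2 ι hι X
  have h2 := Summit.KontsevichZagierPeriods.HyperbolicBloch.ZagierDilogarithmGaloisDescent.distrib_iota_symLift_sub_mem
    hs1 hs2 ι hι Y
  have h3 := add_mem (add_mem h1 (AddSubgroup.zsmul_mem _ h2 ε)) hιE
  have e : (FreeAbelianGroup.of ((X : Q) : ℂ) - ι (s X)) + ε • (FreeAbelianGroup.of ((Y : Q) : ℂ) - ι (s Y)) +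
      ι (s X + ε • s Y) = FreeAbelianGroup.of x + ε • FreeAbelianGroup.of y := by
    simp only [map_add, map_zsmul]
    show (FreeAbelianGroup.of x - ι (s X)) + ε • (FreeAbelianGroup.of y - ι (s Y)) + (ι (s X) + ε • ι (s Y)) = _
    module
  rwa [e] at h3

variable {x y : ℂ}

/-- `[x] + [x⁻¹] ∈ ⟨dilogRelators⟩` for algebraic `x ∉ {0,1}` (with `y = x⁻¹` given by `x * y = 1`). [cite: Neumann1998, §2 eq. (2.3)] -/
theorem anh_inv (hx : IsAlgebraic ℚ x) (_h0 : x ≠ 0) (_h1 : x ≠ 1) (h : x * y = 1) :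
    FreeAbelianGroup.of x + FreeAbelianGroup.of y ∈ AddSubgroup.closure dilogRelators := by
  have hy : y = x⁻¹ := (eq_inv_of_mul_eq_one_right h)
  have hya : IsAlgebraic ℚ y := by rw [hy]; exact hx.inv
  have := of_add_zsmul_of_mem_of_sym x y 1 hx hya (fun Q _ X Y hX hY => by
    have hXY : Y = X⁻¹ := by
      apply Subtype.ext
      rw [show ((X⁻¹ : Q) : ℂ) = ((X : Q) : ℂ)⁻¹ from rfl, hX, hY, hy]
    rw [hXY, one_smul, PreBloch.sym_inv, add_neg_cancel])
  simpa using this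

/-- `[x] + [1 − x] ∈ ⟨dilogRelators⟩` for algebraic `x ∉ {0,1}` (with `x + y = 1`). [cite: Neumann1998, §2 eq. (2.3)] -/
theorem anh_one_sub (hx : IsAlgebraic ℚ x) (_h0 : x ≠ 0) (_h1 : x ≠ 1) (h : x + y = 1) :
    FreeAbelianGroup.of x + FreeAbelianGroup.of y ∈ AddSubgroup.closure dilogRelators := by
  have hy : y = 1 - x := by linear_combination h
  have hya : IsAlgebraic ℚ y := by rw [hy]; exact isAlgebraic_one.sub hx
  have := of_add_zsmul_of_mem_of_sym x y 1 hx hya (fun Q _ X Y hX hY => by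
    have hXY : Y = 1 - X := by
      apply Subtype.ext
      rw [show (((1 - X : Q)) : ℂ) = 1 - ((X : Q) : ℂ) from rfl, hX, hY, hy]
    rw [hXY, one_smul, PreBloch.sym_one_sub, add_neg_cancel])
  simpa using this

/-- `[x] − [(1 − x)⁻¹] ∈ ⟨dilogRelators⟩` for algebraic `x ∉ {0,1}` (with `y * (1 − x) = 1`). [cite: Neumann1998, §2 eq. (2.3)] -/
theorem anh_inv_one_sub (hx : IsAlgebraic ℚ x) (_h0 : x ≠ 0) (h1 : x ≠ 1) (h : y * (1 - x) = 1) :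
    FreeAbelianGroup.of x - FreeAbelianGroup.of y ∈ AddSubgroup.closure dilogRelators := by
  have h1' : (1 - x) ≠ 0 := sub_ne_zero.2 (Ne.symm h1)
  have hy : y = (1 - x)⁻¹ := eq_inv_of_mul_eq_one_left h
  have hya : IsAlgebraic ℚ y := by rw [hy]; exact (isAlgebraic_one.sub hx).inv
  have := of_add_zsmul_of_mem_of_sym x y (-1) hx hya (fun Q _ X Y hX hY => by
    have hXY : Y = (1 - X)⁻¹ := by
      apply Subtype.ext
      rw [show ((((1 - X)⁻¹ : Q)) : ℂ) = (1 - ((X : Q) : ℂ))⁻¹ from rfl, hX, hY, hy]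
    rw [hXY, PreBloch.sym_inv_one_sub, neg_one_smul, add_neg_cancel])
  simpa [sub_eq_add_neg] using this

/-- `[x] − [1 − x⁻¹] ∈ ⟨dilogRelators⟩` for algebraic `x ∉ {0,1}` (with `(1 − y) * x = 1`). [cite: Neumann1998, §2 eq. (2.3)] -/
theorem anh_one_sub_inv (hx : IsAlgebraic ℚ x) (_h0 : x ≠ 0) (_h1 : x ≠ 1) (h : (1 - y) * x = 1) :
    FreeAbelianGroup.of x - FreeAbelianGroup.of y ∈ AddSubgroup.closure dilogRelators := by
  have hy : y = 1 - x⁻¹ := by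
    have e : 1 - y = x⁻¹ := eq_inv_of_mul_eq_one_left h
    linear_combination -e
  have hya : IsAlgebraic ℚ y := by rw [hy]; exact isAlgebraic_one.sub hx.inv
  have := of_add_zsmul_of_mem_of_sym x y (-1) hx hya (fun Q _ X Y hX hY => by
    have hXY : Y = 1 - X⁻¹ := by
      apply Subtype.ext
      rw [show (((1 - X⁻¹ : Q)) : ℂ) = 1 - ((X : Q) : ℂ)⁻¹ from rfl, hX, hY, hy]
    rw [hXY, PreBloch.sym_one_sub_inv, neg_one_smul, add_neg_cancel])
  simpa [sub_eq_add_neg] using this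

/-- `[x] + [x/(x − 1)] ∈ ⟨dilogRelators⟩` for algebraic `x ∉ {0,1}` (with `y * (x − 1) = x`). [cite: Neumann1998, §2 eq. (2.3)] -/
theorem anh_div_sub_one (hx : IsAlgebraic ℚ x) (_h0 : x ≠ 0) (h1 : x ≠ 1) (h : y * (x - 1) = x) :
    FreeAbelianGroup.of x + FreeAbelianGroup.of y ∈ AddSubgroup.closure dilogRelators := by
  have h1' : (x - 1) ≠ 0 := sub_ne_zero.2 h1
  have hy : y = x / (x - 1) := by rw [eq_div_iff h1']; exact h
  have hya : IsAlgebraic ℚ y := by rw [hy]; exact hx.mul (hx.sub isAlgebraic_one).inv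
  have := of_add_zsmul_of_mem_of_sym x y 1 hx hya (fun Q _ X Y hX hY => by
    have hXY : Y = X / (X - 1) := by
      apply Subtype.ext
      rw [show (((X / (X - 1) : Q)) : ℂ) = ((X : Q) : ℂ) / (((X : Q) : ℂ) - 1) from rfl, hX, hY, hy]
    rw [hXY, one_smul, PreBloch.sym_div_sub_one, add_neg_cancel])
  simpa using this

/-- **Registered stub `stub_anharmonicRelators`** (Gaussian exceptional-unit sector, lead c5 cycle 4): the five anharmonic relators
in `ℤ[ℂ]` modulo `⟨dilogRelators⟩` for algebraic `x ∉ {0,1}`, images given in multiplicative form (conjunction). [cite: Neumann1998, §2 eq. (2.3)] -/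
theorem stub_anharmonicRelators :
    (∀ x y : ℂ, IsAlgebraic ℚ x → x ≠ 0 → x ≠ 1 → x * y = 1 →
        FreeAbelianGroup.of x + FreeAbelianGroup.of y ∈ AddSubgroup.closure dilogRelators) ∧
    (∀ x y : ℂ, IsAlgebraic ℚ x → x ≠ 0 → x ≠ 1 → x + y = 1 →
        FreeAbelianGroup.of x + FreeAbelianGroup.of y ∈ AddSubgroup.closure dilogRelators) ∧
    (∀ x y : ℂ, IsAlgebraic ℚ x → x ≠ 0 → x ≠ 1 → y * (1 - x) = 1 →
        FreeAbelianGroup.of x - FreeAbelianGroup.of y ∈ AddSubgroup.closure dilogRelators) ∧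
    (∀ x y : ℂ, IsAlgebraic ℚ x → x ≠ 0 → x ≠ 1 → (1 - y) * x = 1 →
        FreeAbelianGroup.of x - FreeAbelianGroup.of y ∈ AddSubgroup.closure dilogRelators) ∧
    (∀ x y : ℂ, IsAlgebraic ℚ x → x ≠ 0 → x ≠ 1 → y * (x - 1) = x →
        FreeAbelianGroup.of x + FreeAbelianGroup.of y ∈ AddSubgroup.closure dilogRelators) :=
  ⟨fun _ _ => anh_inv, fun _ _ => anh_one_sub, fun _ _ => anh_inv_one_sub, fun _ _ => anh_one_sub_inv,
    fun _ _ => anh_div_sub_one⟩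

end Summit.KontsevichZagierPeriods.HyperbolicBloch.ZagierDilogarithmCertificate

end
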